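import Mathlib
import HarnessLib
import Literature.Analysis.FluidPDE.Tao2016AveragedNS.LocalCascadeSolutions
import Literature.Analysis.FluidPDE.Tao2016AveragedNS.RenormalisedCascadeWaves
import Literature.Analysis.FluidPDE.Tao2016AveragedNS.ViscousEternalSolutions
import Literature.Analysis.FluidPDE.Tao2016AveragedNS.SelfSimilarCascadeBlowup
import Literature.Analysis.FluidPDE.Tao2016AveragedNS.BoundedEternalSolutions
import Summits.NavierStokesRegularity.NavierStokesRegularity.Theorems.TaoLadderRungTwoBreakNoSurvivingEternalViscBddOneFrontSpeedLimit
import Summits.NavierStokesRegularity.NavierStokesRegularity.Theorems.WakeRatchetAdmissibleEternalBoundOrthantBound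

/-!
# Crux K1ᵛ(1) `TaoLadderRungTwoBreak.NoSurvivingEternalViscBddOne` (stmt-NavierStokesRegularity-20419), child
# (ρ0) on the SIGN-COHERENT / STRONG-ORTHANT class: ordered ignition, the loud down-set and the front speed
# limit hold UNCONDITIONALLY for inviscid bounded admissible eternal solutions — the dyadic member by name

MODEL lattice ODEs only (Tao 2016 §4 in the self-similar log-time variables of §6.4); nothing in this file
is a statement about the Navier–Stokes equations, and no summit or rung LEAF is proved by it
(`--supports stmt-NavierStokesRegularity-20419 --as helper`).  `C_A = fluxConst α`, `Λ = bigLam ε₀`.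

The tail barrier (`…TailSlaving`, `…TailBarrier`, `…FrontSpeedLimit`) needs ONE hypothesis at `ν̂ = 0`:
a tail that was quiet in some past (for `ν̂ > 0` that is the tree's `farPastDecay_all`).  On the
sign-coherent class — admissible eternal solutions whose bond pairings `⟪W_{k+1}, A W_k⟫` are `≥ 0` at all
times, which is AUTOMATIC for every admissible eternal solution of a strong-orthant table (pure
Katz–Pavlović network, e.g. `dyadicTable`) by route WakeRatchet's `WakeRatchetOrthant.physFlux_nonneg` —
that hypothesis is a THEOREM and much more is immediate:

* `tendsto_norm_atBot_of_isEternal` — every shell of a uniformly bounded admissible INVISCID eternal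
  solution (any table) tends to `0` at `σ → -∞` (`‖W_n‖²` and its derivative are integrable on a left
  half-line: the action clause + the uniform bound; Mathlib's `tendsto_zero_of_hasDerivAt_of_integrableOn_Iic`);
* `exists_quietPast_of_flux_nonneg` — sign-coherent bonds ⇒ every tail is quiet at every level in some
  past (one shell decays by the previous bullet, the shells above are slaved to it by
  `norm_le_slaved_of_flux_nonneg` — no margin needed);
* `orderedIgnition_of_flux_nonneg`, `loud_downset_of_flux_nonneg` — ORDERED IGNITION with NO margin and NO
  quiet-past hypothesis: if shell `k` exceeds `q` by log-time `σ₁`, shell `k-1` exceeded every `M` with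
  `2ΛC_A M² < q` by `σ₁`; at every level `q` with `2ΛC_A q² < q` the loud set is a down-set;
* `frontSpeedLimit_of_flux_nonneg` — the front speed limit of `…FrontSpeedLimit` with the quiet-past
  hypothesis discharged;
* `orthant_orderedIgnition`, `orthant_loud_downset`, `dyadic_loud_downset` — BY NAME on strong-orthant
  tables (every admissible eternal solution, any `ν̂ ≥ 0`; hypotheses = the three Kamke shape conditions
  of `WakeRatchetOrthant`) and on the DYADIC MEMBER `dyadicTable` (every admissible inviscid eternal
  solution of the Katz–Pavlović chain has a monotone front: if shell `k` is loud by `σ₁`, so was every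
  shell below it).

HONEST LABEL: structure lemmas; (ρ0) on the orthant class still needs the WAKE estimate (how much energy
a passing front leaves behind); `stub_noSurvivingEternalBddOne` and ⟨20419⟩ stay OPEN; rung 0.
-/

noncomputable section

-- the summit and its single sub-problem share the name (CONVENTIONS §1)
set_option linter.dupNamespace false

namespace Summit.NavierStokesRegularity.NavierStokesRegularity.Theorems.NoSurvivingEternalViscBddOne.TailBarrier

open Set Filter Topology MeasureTheory
open scoped RealInnerProductSpace
open Literature.Analysis.FluidPDE Literature.Analysis.FluidPDE.TaoCascade
open Summit.NavierStokesRegularity.NavierStokesRegularity.Theorems.WakeRatchetOrthant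
  (physFlux_nonneg quasiPositive_iff_strongOrthant uniformBound_of_orthant quasiPositive_dyadicTable)

variable {m : ℕ} {ε₀ νh : ℝ} {α : Fin m → Fin m → Fin m → ℤ × ℤ × ℤ → ℝ} {W : ℤ → ℝ → Em m}

/-! ## Inviscid shells vanish at `-∞` -/

/-- **Every shell of a uniformly bounded admissible inviscid eternal solution tends to `0` at `-∞`**
(any table, any `ε₀ > 0`): `‖W_n‖² ≤ B‖W_n‖` and `|(‖W_n‖²)'| ≤ 2K‖W_n‖` are integrable by the action
clause and the uniform bound (`K` bounds `‖W_n'‖` through the lattice law).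
[cite: Tao2016AveragedNS, §4 Lemma 4.1 (4.8) in the self-similar variables of §6.4; cell admissibility clauses of `IsEternal`] -/
theorem tendsto_norm_atBot_of_isEternal (hε : 0 < ε₀) (hW : IsEternal ε₀ α W)
    {B : ℝ} (hB : ∀ (k : ℤ) (σ : ℝ), ‖W k σ‖ ≤ B) (n : ℤ) :
    Tendsto (fun σ => ‖W n σ‖) atBot (𝓝 0) := by
  have hB0 : 0 ≤ B := (norm_nonneg _).trans (hB n 0)
  have hΛ : 0 < bigLam ε₀ := bigLam_pos (by linarith)
  have hcont : ∀ k, Continuous (W k) := fun k =>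
    continuous_iff_continuousAt.2 fun x => (hW.law k x).continuousAt
  obtain ⟨Mact, hact⟩ := hW.action
  have hint : Integrable (fun σ => ‖W n σ‖) := (hact n).1
  -- the derivative bound
  set CQ : ℝ := shiftConst α (0, 0, 0) with hCQ
  set CA : ℝ := shiftConst α (0, 0, 1) with hCA
  set CB : ℝ := shiftConst α (1, 0, 0) + shiftConst α (0, 1, 0) with hCB
  have hCQ0 : 0 ≤ CQ := shiftConst_nonneg α _
  have hCA0 : 0 ≤ CA := shiftConst_nonneg α _
  have hCB0 : 0 ≤ CB := add_nonneg (shiftConst_nonneg α _) (shiftConst_nonneg α _)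
  set K : ℝ := B + CQ * B ^ 2 + bigLam ε₀ * (CA * B ^ 2) + (bigLam ε₀)⁻¹ * (CB * B * B) with hK
  have hK0 : 0 ≤ K := by positivity
  have hderiv_bound : ∀ x, ‖deriv (W n) x‖ ≤ K := by
    intro x
    rw [(hW.law n x).deriv]
    have h1 : ‖-((1 : ℝ) • W n x)‖ ≤ B := by rw [norm_neg, one_smul]; exact hB n x
    have h2 : ‖tableQ α (W n x)‖ ≤ CQ * B ^ 2 :=
      (norm_tableQ_le α _).trans
        (mul_le_mul_of_nonneg_left (pow_le_pow_left₀ (norm_nonneg _) (hB n x) 2) hCQ0)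
    have h3 : ‖bigLam ε₀ • tableA α (W (n - 1) x)‖ ≤ bigLam ε₀ * (CA * B ^ 2) := by
      rw [norm_smul, Real.norm_eq_abs, abs_of_pos hΛ]
      exact mul_le_mul_of_nonneg_left ((norm_tableA_le α _).trans
        (mul_le_mul_of_nonneg_left (pow_le_pow_left₀ (norm_nonneg _) (hB _ _) 2) hCA0)) hΛ.le
    have h4 : ‖(bigLam ε₀)⁻¹ • tableB α (W (n + 1) x) (W n x)‖ ≤ (bigLam ε₀)⁻¹ * (CB * B * B) := by
      rw [norm_smul, Real.norm_eq_abs, abs_of_pos (inv_pos.2 hΛ)]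
      refine mul_le_mul_of_nonneg_left ?_ (inv_pos.2 hΛ).le
      calc ‖tableB α (W (n + 1) x) (W n x)‖ ≤ CB * ‖W (n + 1) x‖ * ‖W n x‖ := norm_tableB_le α _ _
        _ ≤ CB * B * B := by
            apply mul_le_mul (mul_le_mul_of_nonneg_left (hB _ _) hCB0) (hB n x) (norm_nonneg _)
            positivity
    calc ‖-((1 : ℝ) • W n x) + tableQ α (W n x) + bigLam ε₀ • tableA α (W (n - 1) x)
          + (bigLam ε₀)⁻¹ • tableB α (W (n + 1) x) (W n x)‖
        ≤ ‖-((1 : ℝ) • W n x) + tableQ α (W n x) + bigLam ε₀ • tableA α (W (n - 1) x)‖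
          + ‖(bigLam ε₀)⁻¹ • tableB α (W (n + 1) x) (W n x)‖ := norm_add_le _ _
      _ ≤ (‖-((1 : ℝ) • W n x) + tableQ α (W n x)‖ + ‖bigLam ε₀ • tableA α (W (n - 1) x)‖)
          + ‖(bigLam ε₀)⁻¹ • tableB α (W (n + 1) x) (W n x)‖ := by
          gcongr; exact norm_add_le _ _
      _ ≤ ((‖-((1 : ℝ) • W n x)‖ + ‖tableQ α (W n x)‖) + ‖bigLam ε₀ • tableA α (W (n - 1) x)‖)
          + ‖(bigLam ε₀)⁻¹ • tableB α (W (n + 1) x) (W n x)‖ := by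
          gcongr; exact norm_add_le _ _
      _ ≤ ((B + CQ * B ^ 2) + bigLam ε₀ * (CA * B ^ 2)) + (bigLam ε₀)⁻¹ * (CB * B * B) := by
          gcongr
      _ = K := by rw [hK]
  have hf : ∀ x ∈ Iic (0 : ℝ), HasDerivAt (fun y => ‖W n y‖ ^ 2) (2 * ⟪W n x, deriv (W n) x⟫) x :=
    fun x _ => ((hW.law n x).differentiableAt.hasDerivAt).norm_sq
  have hf'meas : AEStronglyMeasurable (fun x => 2 * ⟪W n x, deriv (W n) x⟫)
      (volume.restrict (Iic (0 : ℝ))) := by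
    have h1 : Measurable (fun x => ⟪W n x, deriv (W n) x⟫) :=
      (hcont n).measurable.inner (measurable_deriv (W n))
    exact (h1.const_mul 2).aestronglyMeasurable
  have hf'int : IntegrableOn (fun x => 2 * ⟪W n x, deriv (W n) x⟫) (Iic (0 : ℝ)) := by
    refine Integrable.mono' ((hint.const_mul (2 * K)).integrableOn) hf'meas
      (Eventually.of_forall fun x => ?_)
    rw [Real.norm_eq_abs, abs_mul, abs_two]
    calc 2 * |⟪W n x, deriv (W n) x⟫| ≤ 2 * (‖W n x‖ * ‖deriv (W n) x‖) :=
          mul_le_mul_of_nonneg_left (abs_real_inner_le_norm _ _) two_pos.le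
      _ ≤ 2 * (‖W n x‖ * K) :=
          mul_le_mul_of_nonneg_left (mul_le_mul_of_nonneg_left (hderiv_bound x) (norm_nonneg _))
            two_pos.le
      _ = 2 * K * ‖W n x‖ := by ring
  have hfint : IntegrableOn (fun y => ‖W n y‖ ^ 2) (Iic (0 : ℝ)) := by
    refine Integrable.mono' ((hint.const_mul B).integrableOn)
      (((hcont n).norm.pow 2).aestronglyMeasurable) (Eventually.of_forall fun x => ?_)
    rw [Real.norm_eq_abs, abs_of_nonneg (by positivity)]
    calc ‖W n x‖ ^ 2 = ‖W n x‖ * ‖W n x‖ := sq _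
      _ ≤ B * ‖W n x‖ := mul_le_mul_of_nonneg_right (hB n x) (norm_nonneg _)
  have hsq : Tendsto (fun y => ‖W n y‖ ^ 2) atBot (𝓝 0) :=
    tendsto_zero_of_hasDerivAt_of_integrableOn_Iic hf hf'int hfint
  have hsqrt := (Real.continuous_sqrt.tendsto 0).comp hsq
  rw [Real.sqrt_zero] at hsqrt
  refine hsqrt.congr fun x => ?_
  simp only [Function.comp_apply, Real.sqrt_sq (norm_nonneg _)]

/-! ## Sign-coherent bonds: the quiet past is automatic, ordered ignition needs no margin -/

/-- **Sign-coherent bonds ⇒ every tail is quiet in some past** (inviscid, cancelling table): if all bond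
pairings `⟪W_{k+1}, A W_k⟫` are `≥ 0`, then for every shell `n` and level `q > 0` there is `σ₀` with
`‖W_k(s)‖ ≤ q` for all `k ≥ n`, `s ≤ σ₀` (shell `n` decays at `-∞`; the shells above are slaved to it,
`norm_le_slaved_of_flux_nonneg`, at a level `≤ min(q, 1/(2ΛC_A+1))` which the squaring map does not
increase).
[cite: Tao2016AveragedNS, §1.2, §4 (4.1), (4.3), Lemma 4.1 (4.8); §6.4] -/
theorem exists_quietPast_of_flux_nonneg (hε : 0 < ε₀) (hW : IsEternal ε₀ α W) (hc : IsCancellingCoeff α)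
    {B : ℝ} (hB : ∀ (k : ℤ) (σ : ℝ), ‖W k σ‖ ≤ B)
    (hflux : ∀ (k : ℤ) (σ : ℝ), 0 ≤ ⟪W (k + 1) σ, tableA α (W k σ)⟫) (n : ℤ) {q : ℝ} (hq : 0 < q) :
    ∃ σ₀ : ℝ, ∀ k : ℤ, n ≤ k → ∀ s, s ≤ σ₀ → ‖W k s‖ ≤ q := by
  have hΛ : 0 < bigLam ε₀ := bigLam_pos (by linarith)
  have hCA : 0 ≤ fluxConst α := fluxConst_nonneg α
  set c : ℝ := 2 * bigLam ε₀ * fluxConst α with hcdef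
  have hc0 : 0 ≤ c := by positivity
  set q' : ℝ := min q (1 / (c + 1)) with hq'
  have hq'0 : 0 < q' := lt_min hq (by positivity)
  have hq'q : q' ≤ q := min_le_left _ _
  have hq'c : c * q' ≤ 1 := by
    have h1 : q' ≤ 1 / (c + 1) := min_le_right _ _
    have h2 : c * q' ≤ c * (1 / (c + 1)) := mul_le_mul_of_nonneg_left h1 hc0
    have h3 : c * (1 / (c + 1)) ≤ 1 := by
      rw [mul_one_div, div_le_one (by linarith)]; linarith
    exact h2.trans h3
  -- shell n is eventually ≤ q' in the far past
  have hev : ∀ᶠ s in atBot, ‖W n s‖ ≤ q' :=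
    (tendsto_norm_atBot_of_isEternal hε hW hB n).eventually (eventually_le_nhds hq'0)
  obtain ⟨σ₀, hσ₀⟩ := eventually_atBot.1 hev
  refine ⟨σ₀, ?_⟩
  have hE : IsEternalVisc ε₀ 0 α W := hW.isEternalVisc
  -- induction up the tail
  have key : ∀ j : ℕ, ∀ s, s ≤ σ₀ → ‖W (n + j) s‖ ≤ q' := by
    intro j
    induction j with
    | zero => intro s hs; simpa using hσ₀ s hs
    | succ j ih =>
      intro s hs
      have hdrv : ∀ s', s' ≤ σ₀ → ‖W (n + (j + 1 : ℕ) - 1) s'‖ ≤ q' := by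
        intro s' hs'
        have : n + ((j + 1 : ℕ) : ℤ) - 1 = n + (j : ℕ) := by push_cast; ring
        rw [this]; exact ih s' hs'
      have h := norm_le_slaved_of_flux_nonneg hε hE hc hdrv (fun s' _ => hflux _ s')
        (fun s' _ => hB _ s') s hs
      calc ‖W (n + (j + 1 : ℕ)) s‖ ≤ 2 * bigLam ε₀ * fluxConst α * q' ^ 2 := h
        _ = (c * q') * q' := by rw [hcdef]; ring
        _ ≤ 1 * q' := mul_le_mul_of_nonneg_right hq'c hq'0.le
        _ = q' := one_mul _
  intro k hk s hs
  obtain ⟨j, hj⟩ : ∃ j : ℕ, k = n + j := ⟨(k - n).toNat, by omega⟩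
  rw [hj]
  exact (key j s hs).trans hq'q

/-- **ORDERED IGNITION on the sign-coherent class — no margin, no quiet-past hypothesis** (any `ν̂ ≥ 0`,
cancelling table, bounded solution): if all bond pairings are `≥ 0` and shell `k` exceeds a level `q` at
some log-time `s ≤ σ₁`, then shell `k - 1` exceeded every level `M` with `2ΛC_A M² < q` at some log-time
`≤ σ₁` (contrapositive of `norm_le_slaved_of_flux_nonneg`).
[cite: Tao2016AveragedNS, §1.2, §4 (4.1), (4.3), Lemma 4.1 (4.8); §5; §6.4] -/
theorem orderedIgnition_of_flux_nonneg (hε : 0 < ε₀) (hW : IsEternalVisc ε₀ νh α W)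
    (hc : IsCancellingCoeff α) {B : ℝ} (hB : ∀ (k : ℤ) (σ : ℝ), ‖W k σ‖ ≤ B)
    (hflux : ∀ (k : ℤ) (σ : ℝ), 0 ≤ ⟪W (k + 1) σ, tableA α (W k σ)⟫)
    {k : ℤ} {σ₁ s q : ℝ} (hs : s ≤ σ₁) (hloud : q < ‖W k s‖)
    {M : ℝ} (hMq : 2 * bigLam ε₀ * fluxConst α * M ^ 2 < q) :
    ∃ s', s' ≤ σ₁ ∧ M < ‖W (k - 1) s'‖ := by
  by_contra hcon
  push Not at hcon
  have h := norm_le_slaved_of_flux_nonneg hε hW hc hcon (fun s' _ => hflux k s')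
    (fun s' _ => hB k s') s hs
  linarith

/-- **The loud set is a down-set on the sign-coherent class** (any `ν̂ ≥ 0`): at every level `q` with
`2ΛC_A q² < q`, if shell `k` is loud (`> q`) by log-time `σ₁` then every shell `j ≤ k` was loud by `σ₁`.
[cite: Tao2016AveragedNS, §1.2, §4 (4.1), (4.3), Lemma 4.1 (4.8); §5; §6.4] -/
theorem loud_downset_of_flux_nonneg (hε : 0 < ε₀) (hW : IsEternalVisc ε₀ νh α W)
    (hc : IsCancellingCoeff α) {B : ℝ} (hB : ∀ (k : ℤ) (σ : ℝ), ‖W k σ‖ ≤ B)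
    (hflux : ∀ (k : ℤ) (σ : ℝ), 0 ≤ ⟪W (k + 1) σ, tableA α (W k σ)⟫)
    {q : ℝ} (hq2 : 2 * bigLam ε₀ * fluxConst α * q ^ 2 < q)
    {k : ℤ} {σ₁ s : ℝ} (hs : s ≤ σ₁) (hloud : q < ‖W k s‖) :
    ∀ j : ℤ, j ≤ k → ∃ s', s' ≤ σ₁ ∧ q < ‖W j s'‖ := by
  suffices H : ∀ d : ℕ, ∀ j : ℤ, j = k - d → ∃ s', s' ≤ σ₁ ∧ q < ‖W j s'‖ by
    intro j hj
    obtain ⟨d, hd⟩ : ∃ d : ℕ, j = k - d := ⟨(k - j).toNat, by omega⟩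
    exact H d j hd
  intro d
  induction d with
  | zero =>
    intro j hj
    simp only [Nat.cast_zero, sub_zero] at hj
    subst hj
    exact ⟨s, hs, hloud⟩
  | succ d ih =>
    intro j hj
    obtain ⟨s', hs', hloud'⟩ := ih (k - d) rfl
    have hjn : j = (k - d) - 1 := by rw [hj]; push_cast; ring
    obtain ⟨s'', hs'', h''⟩ := orderedIgnition_of_flux_nonneg hε hW hc hB hflux hs' hloud' hq2
    exact ⟨s'', hs'', by rw [hjn]; exact h''⟩

/-- **The front speed limit on the sign-coherent class, unconditionally** (inviscid): with `b = 2ΛC_A B²`,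
a margin level `q` (`4 C_A q ≤ Λ`, `2ΛC_A q² < q`, `q < b`), `a = 2ΛC_A q²`,
`Δ = log((b² - a²)/(b² - q²))`: if shell `n` satisfies `‖W_n‖ ≤ q` on `(-∞, σ]`, then every shell
`k ≥ n + j` satisfies `‖W_k(t)‖ ≤ q` for `t ≤ σ + jΔ` — the quiet past needed by `frontSpeedLimit` is supplied
by `exists_quietPast_of_flux_nonneg`.
[cite: Tao2016AveragedNS, §1.2, §4 (4.1), (4.3), Lemma 4.1 (4.8); §5; §6.4] -/
theorem frontSpeedLimit_of_flux_nonneg (hε : 0 < ε₀) (hW : IsEternal ε₀ α W) (hc : IsCancellingCoeff α)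
    {B : ℝ} (hB : ∀ (k : ℤ) (σ : ℝ), ‖W k σ‖ ≤ B)
    (hflux : ∀ (k : ℤ) (σ : ℝ), 0 ≤ ⟪W (k + 1) σ, tableA α (W k σ)⟫) {n : ℤ} {σ q : ℝ}
    (hq4 : 4 * fluxConst α * q ≤ bigLam ε₀) (hq2 : 2 * bigLam ε₀ * fluxConst α * q ^ 2 < q)
    (hqb : q < 2 * bigLam ε₀ * fluxConst α * B ^ 2)
    (hn : ∀ s, s ≤ σ → ‖W n s‖ ≤ q) :
    ∀ (j : ℕ) (k : ℤ), n + j ≤ k → ∀ t,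
      t ≤ σ + j * Real.log (((2 * bigLam ε₀ * fluxConst α * B ^ 2) ^ 2
              - (2 * bigLam ε₀ * fluxConst α * q ^ 2) ^ 2)
            / ((2 * bigLam ε₀ * fluxConst α * B ^ 2) ^ 2 - q ^ 2)) →
      ‖W k t‖ ≤ q := by
  have hΛ : 0 < bigLam ε₀ := bigLam_pos (by linarith)
  have hCA : 0 ≤ fluxConst α := fluxConst_nonneg α
  have hq0 : 0 < q := lt_of_le_of_lt (by positivity) hq2
  obtain ⟨σ₀, hσ₀⟩ := exists_quietPast_of_flux_nonneg hε hW hc hB hflux (n + 1) hq0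
  have h0 : ∀ k : ℤ, n + 1 ≤ k → ∀ s, s ≤ min σ₀ σ → ‖W k s‖ ≤ q :=
    fun k hk s hs => hσ₀ k hk s (hs.trans (min_le_left _ _))
  exact frontSpeedLimit hε hW.isEternalVisc hc hB (min_le_right σ₀ σ) hq4 hq2 hqb h0 hn

/-! ## By name: strong-orthant tables and the dyadic member -/

/-- On a strong-orthant table (feeds `(A y)_i ≥ 0`, in-shell components `(Q x)_i ≥ 0` on `{x_i = 0}`,
diagonal back-reaction) every admissible eternal solution (any `ν̂ ≥ 0`) has non-negative bond pairings
(route WakeRatchet's `physFlux_nonneg`, with the positive prefactor of `physFlux` removed).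
[cite: Tao2016AveragedNS, §1.2, §4 (4.1), Lemma 4.1 (4.9); tree `WakeRatchetOrthant.physFlux_nonneg`] -/
theorem inner_tableA_nonneg_of_orthant (hε : 0 < ε₀) (hW : IsEternalVisc ε₀ νh α W)
    (hA : ∀ (i : Fin m) (y : Em m), 0 ≤ tableA α y i)
    (hQ : ∀ (i : Fin m) (x : Em m), x i = 0 → 0 ≤ tableQ α x i)
    (hBk : ∀ (i : Fin m) (z x : Em m), x i = 0 → tableB α z x i = 0) (k : ℤ) (σ : ℝ) :
    0 ≤ ⟪W (k + 1) σ, tableA α (W k σ)⟫ := by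
  have hΛ : 0 < bigLam ε₀ := bigLam_pos (by linarith)
  have h := physFlux_nonneg hε hW hA hQ hBk k σ
  unfold physFlux at h
  have hc1 : 0 < 2 * ((bigLam ε₀ ^ k)⁻¹ ^ 2 * (bigLam ε₀)⁻¹) := by
    have := zpow_pos hΛ k
    positivity
  have h2 := (mul_nonneg_iff_of_pos_left hc1).1 h
  exact (mul_nonneg_iff_of_pos_left (Real.exp_pos _)).1 h2

/-- **ORDERED IGNITION on strong-orthant tables, by name** (any `ν̂ ≥ 0`, cancelling table, uniformly bounded
admissible eternal solution — no sign, flux, margin or quiet-past hypothesis on the solution): if shell `k`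
exceeds `q` by `σ₁`, shell `k - 1` exceeded every `M` with `2ΛC_A M² < q` by `σ₁`.
[cite: Tao2016AveragedNS, §1.2, §4 (4.1), (4.3), Lemma 4.1 (4.8); §5; §6.4] -/
theorem orthant_orderedIgnition (hε : 0 < ε₀) (hW : IsEternalVisc ε₀ νh α W) (hc : IsCancellingCoeff α)
    (hA : ∀ (i : Fin m) (y : Em m), 0 ≤ tableA α y i)
    (hQ : ∀ (i : Fin m) (x : Em m), x i = 0 → 0 ≤ tableQ α x i)
    (hBk : ∀ (i : Fin m) (z x : Em m), x i = 0 → tableB α z x i = 0)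
    (hU : UniformBound W) {k : ℤ} {σ₁ s q : ℝ} (hs : s ≤ σ₁) (hloud : q < ‖W k s‖)
    {M : ℝ} (hMq : 2 * bigLam ε₀ * fluxConst α * M ^ 2 < q) :
    ∃ s', s' ≤ σ₁ ∧ M < ‖W (k - 1) s'‖ := by
  obtain ⟨B, hB⟩ := hU
  exact orderedIgnition_of_flux_nonneg hε hW hc hB
    (fun k σ => inner_tableA_nonneg_of_orthant hε hW hA hQ hBk k σ) hs hloud hMq

/-- **The loud set is a down-set on strong-orthant tables, by name** (any `ν̂ ≥ 0`, cancelling table,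
uniformly bounded admissible eternal solution): at every level `q` with `2ΛC_A q² < q`, loudness of shell
`k` by `σ₁` forces loudness of every shell `j ≤ k` by `σ₁`.
[cite: Tao2016AveragedNS, §1.2, §4 (4.1), (4.3), Lemma 4.1 (4.8); §5; §6.4] -/
theorem orthant_loud_downset (hε : 0 < ε₀) (hW : IsEternalVisc ε₀ νh α W) (hc : IsCancellingCoeff α)
    (hA : ∀ (i : Fin m) (y : Em m), 0 ≤ tableA α y i)
    (hQ : ∀ (i : Fin m) (x : Em m), x i = 0 → 0 ≤ tableQ α x i)
    (hBk : ∀ (i : Fin m) (z x : Em m), x i = 0 → tableB α z x i = 0)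
    (hU : UniformBound W) {q : ℝ} (hq2 : 2 * bigLam ε₀ * fluxConst α * q ^ 2 < q)
    {k : ℤ} {σ₁ s : ℝ} (hs : s ≤ σ₁) (hloud : q < ‖W k s‖) :
    ∀ j : ℤ, j ≤ k → ∃ s', s' ≤ σ₁ ∧ q < ‖W j s'‖ := by
  obtain ⟨B, hB⟩ := hU
  exact loud_downset_of_flux_nonneg hε hW hc hB
    (fun k σ => inner_tableA_nonneg_of_orthant hε hW hA hQ hBk k σ) hq2 hs hloud

/-- **THE DYADIC MEMBER BY NAME**: every admissible inviscid eternal solution of the Katz–Pavlović chain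
`dyadicTable` (automatically uniformly bounded, `WakeRatchetOrthant.uniformBound_of_orthant`) has a MONOTONE
FRONT — at every level `q` with `2ΛC_A q² < q`, if shell `k` is loud by `σ₁`, every shell `j ≤ k` was loud by
`σ₁` (`ε₀ > 0`; no hypothesis on the solution).
[cite: Tao2016AveragedNS, §1.2 (the dyadic Katz–Pavlović model), §4 (4.1), (4.3), Lemma 4.1 (4.8); §6.4] -/
theorem dyadic_loud_downset (hε : 0 < ε₀) {W : ℤ → ℝ → Em 4} (hW : IsEternal ε₀ dyadicTable W)
    {q : ℝ} (hq2 : 2 * bigLam ε₀ * fluxConst dyadicTable * q ^ 2 < q)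
    {k : ℤ} {σ₁ s : ℝ} (hs : s ≤ σ₁) (hloud : q < ‖W k s‖) :
    ∀ j : ℤ, j ≤ k → ∃ s', s' ≤ σ₁ ∧ q < ‖W j s'‖ := by
  obtain ⟨hA, hQ, hBk⟩ := (quasiPositive_iff_strongOrthant dyadicTable).1 quasiPositive_dyadicTable
  have hα : InTableClass 2 dyadicTable := inTableClass_dyadicTable le_rfl
  have hU : UniformBound W := uniformBound_of_orthant hε hα.2.1 hW hA hQ hBk
  exact orthant_loud_downset hε hW.isEternalVisc hα.2.1 hA hQ hBk hU hq2 hs hloud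

/-- **The dyadic member: quiet past and front speed limit, unconditionally.**  Every admissible inviscid eternal
solution `W` of `dyadicTable` with `‖W‖ ≤ B` obeys the front speed limit of `frontSpeedLimit_of_flux_nonneg`:
if shell `n` has not reached the margin level `q` by `σ`, no shell `k ≥ n + j` reaches it before `σ + jΔ(B,q)`.
[cite: Tao2016AveragedNS, §1.2, §4 (4.1), (4.3), Lemma 4.1 (4.8); §5; §6.4] -/
theorem dyadic_frontSpeedLimit (hε : 0 < ε₀) {W : ℤ → ℝ → Em 4} (hW : IsEternal ε₀ dyadicTable W)
    {B : ℝ} (hB : ∀ (k : ℤ) (σ : ℝ), ‖W k σ‖ ≤ B) {n : ℤ} {σ q : ℝ}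
    (hq4 : 4 * fluxConst dyadicTable * q ≤ bigLam ε₀)
    (hq2 : 2 * bigLam ε₀ * fluxConst dyadicTable * q ^ 2 < q)
    (hqb : q < 2 * bigLam ε₀ * fluxConst dyadicTable * B ^ 2)
    (hn : ∀ s, s ≤ σ → ‖W n s‖ ≤ q) :
    ∀ (j : ℕ) (k : ℤ), n + j ≤ k → ∀ t,
      t ≤ σ + j * Real.log (((2 * bigLam ε₀ * fluxConst dyadicTable * B ^ 2) ^ 2
              - (2 * bigLam ε₀ * fluxConst dyadicTable * q ^ 2) ^ 2)
            / ((2 * bigLam ε₀ * fluxConst dyadicTable * B ^ 2) ^ 2 - q ^ 2)) →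
      ‖W k t‖ ≤ q := by
  obtain ⟨hA, hQ, hBk⟩ := (quasiPositive_iff_strongOrthant dyadicTable).1 quasiPositive_dyadicTable
  have hα : InTableClass 2 dyadicTable := inTableClass_dyadicTable le_rfl
  exact frontSpeedLimit_of_flux_nonneg hε hW hα.2.1 hB
    (fun k σ => inner_tableA_nonneg_of_orthant hε hW.isEternalVisc hA hQ hBk k σ) hq4 hq2 hqb hn

end Summit.NavierStokesRegularity.NavierStokesRegularity.Theorems.NoSurvivingEternalViscBddOne.TailBarrier

end
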